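import Literature.AlgebraicGeometry.HodgeTheory.HolomorphicBundleChernCharacter
import Literature.Geometry.Kaehler.ChernCharacter
import Literature.Geometry.Kaehler.ConnectionExists
import HarnessLib

/-!
# `HodgeModel.chernCharacterSet` is the Chern–Weil Chern character (granted the Chern–Weil facts)

Family `hodge`, layer `Literature/AlgebraicGeometry/HodgeTheory`. Link between the SET
`HodgeModel.chernCharacterSet A V p ⊆ H²ᵖ(X(ℂ); ℂ)` of `HolomorphicBundleChernCharacter` (all classes
whose pull-back to the Hodge model is the comparison image of the class of SOME global Chern–Weil
representative of `ch_p(V)`, rendered as a set because the Chern–Weil theorems were not in the tree) and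
the TERM `SmoothComplexVectorBundle.chernCharacter V A.deRham p ∈ H²ᵖ(X^an; ℂ)` of
`Geometry/Kaehler/ChernCharacter` (the Chern–Weil class transported by `A.deRham`): granted the two
named facts of that file (Kobayashi (1987), Ch. II §2, (2.4) and (2.10)), and since every cocycle on the
Hodge model carries a connection (`Geometry/Kaehler/ConnectionExists`),

  `c ∈ A.chernCharacterSet V p ↔ A.pullback (2 * p) c = V.chernCharacter A.deRham p`

(`mem_chernCharacterSet_iff_pullback_eq_chernCharacter`), i.e. `chernCharacterSet` is the singleton
`pullback⁻¹ {ch_p(V)}` that its docstring announces. All PROVED; no new definitions or facts.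

## References

* [Kobayashi1987] S. Kobayashi, Differential Geometry of Complex Vector Bundles (1987), Ch. II §2
  (2.4), (2.10), Thm. 2.16, (2.21).
* [VoisinHodgeI2002] C. Voisin, Hodge Theory and Complex Algebraic Geometry I (2002), Thm. 11.32.
-/

noncomputable section

open scoped Manifold ContDiff

namespace Literature.AlgebraicGeometry.HodgeTheory

open Literature.Geometry.Kaehler (SmoothComplexVectorBundle MForm IsSmoothForm IsClosedForm)
open Literature.NumberTheory.Transcendental (complexDeRhamCohomology mem_cclosedSmoothForms)
open Literature.AlgebraicTopology.SingularHomology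

variable {n : ℕ} {X : Motives.SchemeOver ℂ}

namespace HodgeModel

/-- `chernCharacterSet` is the preimage under `A.pullback` of the comparison image of
`chernCharacterClassSet` (unfolding of the two definitions). [folklore] -/
theorem mem_chernCharacterSet_iff_exists_mem_chernCharacterClassSet (A : HodgeModel n X) {ι : Type}
    {r : ℕ} (V : SmoothComplexVectorBundle ι A.model A.carrier r) (p : ℕ) (c : complexBetti X (2 * p)) :
    c ∈ A.chernCharacterSet V p ↔
      ∃ c' ∈ V.chernCharacterClassSet p, A.pullback (2 * p) c = A.deRham A.carrier (2 * p) c' := by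
  constructor
  · rintro ⟨D, θ, hs, hc, hθ, h⟩
    exact ⟨_, SmoothComplexVectorBundle.mk_mem_chernCharacterClassSet D hs hc hθ, h⟩
  · rintro ⟨_, ⟨D, θ, hs, hc, hθ, rfl⟩, h⟩
    exact ⟨D, θ, hs, hc, hθ, h⟩

/-- **`chernCharacterSet` is computed by `chernCharacter`** (granted Chern–Weil II): every class in
`A.chernCharacterSet V p` pulls back to THE Chern character `ch_p(V) = V.chernCharacter A.deRham p`
on the Hodge model. [cite: Kobayashi1987, Ch. II §2 (2.10) and Thm. 2.16] -/
theorem pullback_eq_chernCharacter_of_mem_chernCharacterSet (A : HodgeModel n X)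
    (hB : SmoothComplexVectorBundle.mk_eq_mk_of_isChernCharacterForm A.model A.carrier) {ι : Type}
    {r : ℕ} {V : SmoothComplexVectorBundle ι A.model A.carrier r} {p : ℕ} {c : complexBetti X (2 * p)}
    (hc : c ∈ A.chernCharacterSet V p) :
    A.pullback (2 * p) c = V.chernCharacter A.deRham p := by
  obtain ⟨D, θ, hs, hc, hθ, h⟩ := hc
  rw [h, SmoothComplexVectorBundle.chernCharacter_eq hB A.deRham D hs hc hθ]

/-- **`chernCharacterSet = pullback⁻¹ {ch_p(V)}`** (granted both Chern–Weil facts): the set of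
`HolomorphicBundleChernCharacter` is exactly the set of classes whose pull-back to the Hodge model is
`V.chernCharacter A.deRham p` — for `⇐`, the cocycle `V` carries a connection
(`SmoothComplexVectorBundle.nonempty_connection`, partition of unity on the Hausdorff σ-compact
model) and its global Chern–Weil form (Chern–Weil I) represents `ch_p(V)` (Chern–Weil II).
[cite: Kobayashi1987, Ch. II §2 (2.4), (2.10) and Thm. 2.16] -/
theorem mem_chernCharacterSet_iff_pullback_eq_chernCharacter (A : HodgeModel n X)
    (hA : SmoothComplexVectorBundle.exists_isChernCharacterForm A.model A.carrier)
    (hB : SmoothComplexVectorBundle.mk_eq_mk_of_isChernCharacterForm A.model A.carrier) {ι : Type}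
    {r : ℕ} (V : SmoothComplexVectorBundle ι A.model A.carrier r) (p : ℕ) (c : complexBetti X (2 * p)) :
    c ∈ A.chernCharacterSet V p ↔ A.pullback (2 * p) c = V.chernCharacter A.deRham p := by
  refine ⟨A.pullback_eq_chernCharacter_of_mem_chernCharacterSet hB, fun h ↦ ?_⟩
  obtain ⟨D⟩ := V.nonempty_connection
  obtain ⟨θ, hs, hc, hθ⟩ := hA V D p
  exact ⟨D, θ, hs, hc, hθ, by rw [h, SmoothComplexVectorBundle.chernCharacter_eq hB A.deRham D hs hc hθ]⟩

/-- Hence, granted both facts, `chernCharacterSet A V p` is never empty when `A.pullback` hits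
`ch_p(V)` — in particular it contains every class `c` with `A.pullback (2p) c = ch_p(V)`; for the
trivial cocycle in positive degree this is the class `0` (already proved fact-free in
`zero_mem_chernCharacterSet_trivial`). [cite: Kobayashi1987, Ch. II §2 Thm. 2.16] -/
theorem mem_chernCharacterSet_of_pullback_eq (A : HodgeModel n X)
    (hA : SmoothComplexVectorBundle.exists_isChernCharacterForm A.model A.carrier)
    (hB : SmoothComplexVectorBundle.mk_eq_mk_of_isChernCharacterForm A.model A.carrier) {ι : Type}
    {r : ℕ} {V : SmoothComplexVectorBundle ι A.model A.carrier r} {p : ℕ} {c : complexBetti X (2 * p)}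
    (h : A.pullback (2 * p) c = V.chernCharacter A.deRham p) : c ∈ A.chernCharacterSet V p :=
  (A.mem_chernCharacterSet_iff_pullback_eq_chernCharacter hA hB V p c).2 h

end HodgeModel

end Literature.AlgebraicGeometry.HodgeTheory
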